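import Mathlib.Data.List.Infix
import Mathlib.Data.List.Flatten
import Mathlib.Data.List.Range
import Mathlib.Data.List.FinRange
import Mathlib.Data.Nat.Find
import Mathlib.Data.Fintype.Card
import Mathlib.Data.Fintype.EquivFin
import Mathlib.Data.Fintype.Option
import Mathlib.Data.Fintype.Basic
import Mathlib.Data.Finset.Lattice.Fold
import Mathlib.Data.Finset.Card
import Mathlib.Algebra.Group.Opposite
import Mathlib.Algebra.Group.Action.Defs
import Mathlib.Algebra.Group.WithOne.Defs
import Mathlib.Algebra.Order.BigOperators.Group.List
import Mathlib.Order.Monotone.Basic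
import Mathlib.Tactic.Ring
import Mathlib.Tactic.Linarith
import Literature.Combinatorics.Words.VanDerWaerdenCadences
import Literature.Combinatorics.Words.RepetitiveMappings
import HarnessLib

/-!
# Repetitive morphisms (Lothaire 1997, §4.2)

A transcription of §4.2 ("Repetitive morphisms") of Chapter 4 (*Repetitive mappings and
morphisms*, by G. Pirillo) of M. Lothaire, *Combinatorics on Words* (Cambridge Mathematical
Library, 1997), continuing `Literature.Combinatorics.Words.RepetitiveMappings` (§4.1: `k`-th powers
modulo `φ`, uniform powers, repetitive and uniformly repetitive maps, Theorem 4.1.1) and using van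
der Waerden's theorem from `Literature.Combinatorics.Words.VanDerWaerdenCadences` (Theorem 3.1.3,
`vanDerWaerden`; arithmetic cadences, §3.3).

* **Theorem 4.2.1**: if `A` is finite, any morphism `φ : A⁺ → ℙ` into the additive semigroup of
  positive integers is repetitive (`isRepetitive_of_map_append_eq_add`).  The proof is the
  book's: with `m = max φ(a)` and `ξ(a) = b_l ⋯ b₂ b₁` (`l = φ(a)`), van der Waerden's theorem on
  `ξ(w)` — here, on the colouring of the positions `q < φ(w)` by the index `p` of the letter `b_p`
  of `ξ(w)` standing at `q` — gives an arithmetic progression `j₁, …, j_{k+1}` of rate `r`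
  carrying one letter `b_p`; the shortest left factors `uᵢ` with `φ(uᵢ) ≥ jᵢ` have
  `φ(uᵢ) = jᵢ + p − 1`, and `u_{i+1} = uᵢ wᵢ` gives `φ(wᵢ) = r`.
* **Theorem 4.2.2**: a morphism `φ : A⁺ → S` into a FINITE semigroup is uniformly repetitive
  (`isUniformlyRepetitive_of_isSemigroupMorphism`; no finiteness of `A` needed).  The proof is the
  book's induction on `n = Card(S)`, made uniform as the book's "it is possible to choose `p`"
  requires: `UniformPowerBound n k L` says that ONE length `L` works for every semigroup, every
  multiplicatively closed `T ⊇ φ(A⁺)` with `#T ≤ n`, every alphabet and every morphism; the step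
  (`uniformPowerBound_succ`) distinguishes whether `T` has at most one left zero — the main case
  `containsUniformPowerMod_of_atMostOneLeftZero`: cut `w` into `k` factors of length `l`, either
  all are the left zero (a uniform `k`-th power) or one, `u`, is not; van der Waerden on
  `(φ(v₁), …, φ(v_l))` gives `φ(v_j) = φ(v_{j+r}) = ⋯ = φ(v_{j+pr}) = s`, words `yᵢ` of length `r`
  with `s φ(yᵢ) = s`, the proper subsemigroup `T' = {t | s t = s} ⊇ φ(Y⁺)`, and the induction
  hypothesis on `y₁ ⋯ y_p` over the alphabet `Y` — or has several, hence no right zero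
  (`leftZero_unique_of_rightZero`), and the symmetric argument runs in the opposite semigroup
  on reversed words (`IsSemigroupMorphism.reverse_op`, `containsUniformPowerMod_of_reverse`).
* **Van der Waerden's theorem is a particular case of Theorem 4.2.2** (the closing remark of
  §4.2): for the morphism
  of `A⁺` onto its quotient by the congruence generated by `ab ∼ a` — the left-zero semigroup on
  `A` (`LeftZeroBand`, morphism `firstLetter`) — a uniform `k`-th power modulo `φ` yields an
  arithmetic cadence of order `k` (`hasArithCadence_of_containsUniformPowerMod_firstLetter`), so
  Theorem 4.2.2 gives back Proposition 3.3.1 (the tree's `exists_length_forcing_arithCadence`;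
  re-derived only as an `example`).

Conventions (as in §4.1): `A⁺ → E` is a function `List α → E` only ever applied to nonempty
components; "each word of length `l`" is rendered "of length `≥ l`".  A morphism `A⁺ → ℙ` is an
additive map `φ (x ++ y) = φ x + φ y` with `φ [a] ≥ 1`; a morphism into a semigroup is
`IsSemigroupMorphism` (multiplicative on nonempty words, the value at `[]` being irrelevant).

NOT transcribed here: §4.3 (repetitive semigroups: Theorem 4.3.1, Justin 1972, "a deep theorem
with a very long and technical proof") and the Problems.
-/

namespace Literature.Combinatorics.Words

section RepetitiveMorphisms

variable {α : Type*}

/-! ### Factors between cut points -/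

/-- Gluing two consecutive factors `w[a, b) · w[b, c) = w[a, c)` (cut points `a ≤ b ≤ c`).
[cite: Lothaire1997, §4.2 (proof of Theorem 4.2.1: u_{i+1} = u_i w_i)] -/
theorem drop_take_append_drop_take (w : List α) {a b c : ℕ} (hab : a ≤ b) (hbc : b ≤ c) :
    (w.take b).drop a ++ (w.take c).drop b = (w.take c).drop a := by
  rw [List.drop_take, List.drop_take, List.drop_take,
    show c - a = (b - a) + (c - b) by omega, List.take_add, List.drop_drop,
    show a + (b - a) = b by omega]

/-- The factors between consecutive cut points `t 0 ≤ t 1 ≤ ⋯ ≤ t k` glue to `w[t 0, t k)`.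
[cite: Lothaire1997, §4.2 (proof of Theorem 4.2.1: w_1 w_2 ⋯ w_k)] -/
theorem flatten_map_range_drop_take (w : List α) (t : ℕ → ℕ) (ht : ∀ i, t i ≤ t (i + 1))
    (k : ℕ) :
    ((List.range k).map fun i => (w.take (t (i + 1))).drop (t i)).flatten =
      (w.take (t k)).drop (t 0) := by
  have hmono : Monotone t := monotone_nat_of_le_succ ht
  induction k with
  | zero =>
    rw [List.range_zero, List.map_nil, List.flatten_nil, eq_comm]
    exact List.drop_eq_nil_of_le (by simp)
  | succ k ih =>
    rw [List.range_succ, List.map_append, List.flatten_append, ih, List.map_singleton,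
      List.flatten_singleton]
    exact drop_take_append_drop_take w (hmono (Nat.zero_le k)) (ht k)

/-- A factor between two cut points is a factor.
[cite: Lothaire1997, §4.1 (definition of "contains")] -/
theorem drop_take_infix (w : List α) (a b : ℕ) : (w.take b).drop a <:+: w :=
  (List.drop_suffix a _).isInfix.trans (List.take_prefix b w).isInfix

/-! ### §4.2 — morphisms into the positive integers (Theorem 4.2.1) -/

section Positive

variable (φ : List α → ℕ)

/-- A morphism `A⁺ → ℙ` extended to `A*` sends the empty word to `0`.
[cite: Lothaire1997, §4.2 (Theorem 4.2.1, setting)] -/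
theorem map_nil_of_map_append (hφ : ∀ x y, φ (x ++ y) = φ x + φ y) : φ [] = 0 := by
  have h := hφ [] []
  simp only [List.append_nil] at h
  omega

/-- A morphism into `(ℕ, +)` is the sum of the images of the letters.
[cite: Lothaire1997, §4.2 (Theorem 4.2.1, setting)] -/
theorem map_eq_sum_map (hφ : ∀ x y, φ (x ++ y) = φ x + φ y) (w : List α) :
    φ w = (w.map fun a => φ [a]).sum := by
  induction w with
  | nil => simp [map_nil_of_map_append φ hφ]
  | cons a w ih => rw [show a :: w = [a] ++ w from rfl, hφ, ih]; simp

/-- The images of the left factors increase. [cite: Lothaire1997, §4.2 (proof of Theorem 4.2.1: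
the shortest left factor uᵢ with φ(uᵢ) ≥ jᵢ)] -/
theorem map_take_mono (hφ : ∀ x y, φ (x ++ y) = φ x + φ y) (w : List α) {t t' : ℕ}
    (h : t ≤ t') : φ (w.take t) ≤ φ (w.take t') := by
  have h1 : w.take t' = w.take t ++ (w.take t').drop t := by
    conv_lhs => rw [← List.take_append_drop t (w.take t')]
    rw [List.take_take, min_eq_left h]
  rw [h1, hφ]
  omega

/-- `φ(w[a, b)) = φ(w[0, b)) − φ(w[0, a))`. [cite: Lothaire1997, §4.2 (proof of Theorem 4.2.1:
φ(wᵢ) = φ(u_{i+1}) − φ(uᵢ))] -/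
theorem map_drop_take (hφ : ∀ x y, φ (x ++ y) = φ x + φ y) (w : List α) {a b : ℕ}
    (h : a ≤ b) : φ ((w.take b).drop a) = φ (w.take b) - φ (w.take a) := by
  have h1 : w.take b = w.take a ++ (w.take b).drop a := by
    conv_lhs => rw [← List.take_append_drop a (w.take b)]
    rw [List.take_take, min_eq_left h]
  have h2 := hφ (w.take a) ((w.take b).drop a)
  rw [← h1] at h2
  omega

/-- One more letter adds at most `m = max φ(a)`. [cite: Lothaire1997, §4.2 (proof of
Theorem 4.2.1: m = max{φ(a) | a ∈ A})] -/
theorem map_take_succ_le (hφ : ∀ x y, φ (x ++ y) = φ x + φ y) (w : List α) (t m : ℕ)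
    (hm : ∀ a, φ [a] ≤ m) : φ (w.take (t + 1)) ≤ φ (w.take t) + m := by
  rw [List.take_add_one, hφ]
  cases w[t]? with
  | none => simp [map_nil_of_map_append φ hφ]
  | some a => simpa using hm a

/-- With positive letters, `φ` of a left factor is at least its length.
[cite: Lothaire1997, §4.2 (proof of Theorem 4.2.1: |ξ(w)| ≥ n)] -/
theorem length_le_map_take (hφ : ∀ x y, φ (x ++ y) = φ x + φ y) (hpos : ∀ a, 1 ≤ φ [a])
    (w : List α) {t : ℕ} (ht : t ≤ w.length) : t ≤ φ (w.take t) := by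
  rw [map_eq_sum_map φ hφ]
  calc t = ((w.take t).map fun a => φ [a]).length := by simp [ht]
    _ ≤ _ := List.length_le_sum_of_one_le _ (by
        intro i hi
        rw [List.mem_map] at hi
        obtain ⟨a, -, rfl⟩ := hi
        exact hpos a)

open scoped Classical in
/-- **Theorem 4.2.1**: if `A` is finite, any morphism `φ : A⁺ → ℙ` into the additive semigroup of
positive integers is repetitive.  The book's proof: with `m = max φ(a)` and `ξ(a) = b_l ⋯ b₂ b₁`
(`l = φ(a)`), van der Waerden's theorem applied to `ξ(w)` (here: to the colouring of the positions
`q < φ(w)` by the index `p` of the letter `b_p` of `ξ(w)` standing there) gives an arithmetic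
progression `j₁ < ⋯ < j_{k+1}` of rate `r` carrying one letter `b_p`; the shortest left factors
`uᵢ` with `φ(uᵢ) ≥ jᵢ` satisfy `φ(uᵢ) = jᵢ + p − 1`, and `u_{i+1} = uᵢ wᵢ` gives `φ(wᵢ) = r`, so
`w₁ ⋯ w_k` is a `k`-th power modulo `φ`.  (We render `φ : A⁺ → ℙ` as an additive map on lists with
positive values on letters.) [cite: Lothaire1997, Theorem 4.2.1] -/
theorem isRepetitive_of_map_append_eq_add [Finite α] (hφ : ∀ x y, φ (x ++ y) = φ x + φ y)
    (hpos : ∀ a, 1 ≤ φ [a]) : IsRepetitive φ := by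
  haveI := Fintype.ofFinite α
  obtain ⟨m, hm⟩ : ∃ m : ℕ, ∀ a, φ [a] ≤ m :=
    ⟨Finset.univ.sup fun a : α => φ [a],
      fun a => Finset.le_sup (f := fun a : α => φ [a]) (Finset.mem_univ a)⟩
  intro k
  obtain ⟨N, hN⟩ := vanDerWaerden (Fin (m + 1)) (k + 1)
  refine ⟨N + 1, fun w hw => ?_⟩
  -- the partial sums `S t = φ(w[0, t))`
  set S : ℕ → ℕ := fun t => φ (w.take t) with hS
  have hS0 : S 0 = 0 := by simp [hS, map_nil_of_map_append φ hφ]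
  have hSlen : N + 1 ≤ S w.length :=
    le_trans hw (by simpa [hS] using length_le_map_take φ hφ hpos w le_rfl)
  have hSsucc : ∀ t, S (t + 1) ≤ S t + m := fun t => map_take_succ_le φ hφ w t m hm
  -- the first cut point beyond position `q`, and the colour of `q`
  have hfind : ∀ q (h : ∃ t, q < S t), q < S (Nat.find h) ∧ S (Nat.find h) ≤ q + m := by
    intro q h
    refine ⟨Nat.find_spec h, ?_⟩
    have hne : Nat.find h ≠ 0 := by
      intro h0
      have := Nat.find_spec h
      rw [h0, hS0] at this
      exact Nat.not_lt_zero _ this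
    obtain ⟨t', ht'⟩ := Nat.exists_eq_add_one_of_ne_zero hne
    have hmin : ¬ q < S t' := Nat.find_min h (by omega)
    have := hSsucc t'
    rw [ht']
    omega
  let c₀ : ℕ → ℕ := fun q => if h : ∃ t, q < S t then S (Nat.find h) - (q + 1) else 0
  have hc₀ : ∀ q (h : ∃ t, q < S t), c₀ q = S (Nat.find h) - (q + 1) := fun q h => dif_pos h
  have hc₀le : ∀ q, c₀ q ≤ m := by
    intro q
    by_cases h : ∃ t, q < S t
    · rw [hc₀ q h]
      have := (hfind q h).2
      omega
    · simp [c₀, h]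
  let c : ℕ → Fin (m + 1) := fun q => ⟨c₀ q, Nat.lt_succ_of_le (hc₀le q)⟩
  obtain ⟨a, d, hd, hadN, hprog⟩ := hN c
  simp only [Nat.add_sub_cancel] at hadN
  -- the positions `q i = a + i d`, `i ≤ k`, all lie inside `ξ(w)`
  have hq : ∀ i, i ≤ k → ∃ t, a + i * d < S t := by
    intro i hi
    refine ⟨w.length, ?_⟩
    have : a + i * d ≤ a + k * d := by
      have := Nat.mul_le_mul_right d hi
      omega
    omega
  have hcol : ∀ i, i ≤ k → c₀ (a + i * d) = c₀ a := by
    intro i hi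
    have := hprog i (Nat.lt_succ_of_le hi)
    simpa [c] using this
  -- the cut points `t i` = the shortest left factor `uᵢ` with `φ(uᵢ) > q i`
  let t : ℕ → ℕ := fun i => if h : i ≤ k then Nat.find (hq i h) else w.length
  have ht_of_le : ∀ i (h : i ≤ k), t i = Nat.find (hq i h) := fun i h => dif_pos h
  have htS : ∀ i, i ≤ k → S (t i) = a + i * d + 1 + c₀ a := by
    intro i hi
    rw [ht_of_le i hi, ← hcol i hi, hc₀ _ (hq i hi)]
    have := (hfind _ (hq i hi)).1
    omega
  have ht_le_len : ∀ i, t i ≤ w.length := by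
    intro i
    by_cases hi : i ≤ k
    · rw [ht_of_le i hi]
      exact Nat.find_min' _ (by
        have : a + i * d ≤ a + k * d := by
          have := Nat.mul_le_mul_right d hi
          omega
        omega)
    · simp [t, hi]
  have ht_mono : ∀ i, t i ≤ t (i + 1) := by
    intro i
    by_cases hi : i + 1 ≤ k
    · rw [ht_of_le i (by omega), ht_of_le (i + 1) hi]
      refine Nat.find_mono fun n hn => ?_
      have : a + i * d ≤ a + (i + 1) * d := by nlinarith
      omega
    · have : t (i + 1) = w.length := by simp [t, hi]
      rw [this]
      exact ht_le_len i
  -- the components `wᵢ = w[t i, t (i+1))` all have `φ(wᵢ) = d`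
  have hcomp : ∀ i, i < k → φ ((w.take (t (i + 1))).drop (t i)) = d := by
    intro i hi
    rw [map_drop_take φ hφ w (ht_mono i)]
    have h1 := htS i hi.le
    have h2 := htS (i + 1) hi
    simp only [hS] at h1 h2
    rw [h1, h2]
    have : (i + 1) * d = i * d + d := by ring
    omega
  refine ⟨(w.take (t k)).drop (t 0), drop_take_infix w _ _,
    (List.range k).map fun i => (w.take (t (i + 1))).drop (t i), by simp, ?_,
    flatten_map_range_drop_take w t ht_mono k, ?_⟩
  · intro x hx
    rw [List.mem_map] at hx
    obtain ⟨i, hi, rfl⟩ := hx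
    rw [List.mem_range] at hi
    intro hnil
    have := hcomp i hi
    rw [hnil, map_nil_of_map_append φ hφ] at this
    omega
  · intro x hx y hy
    rw [List.mem_map] at hx hy
    obtain ⟨i, hi, rfl⟩ := hx
    obtain ⟨j, hj, rfl⟩ := hy
    rw [List.mem_range] at hi hj
    rw [hcomp i hi, hcomp j hj]

end Positive

/-! ### §4.2 — morphisms into a finite semigroup (Theorem 4.2.2) -/

section Semigroups

universe u v

variable {β : Type u} {S : Type v}

/-- A morphism of semigroups `ψ : A⁺ → S`, rendered on lists: multiplicative on nonempty words
(the value at `[]` is irrelevant). [cite: Lothaire1997, §4.2 (morphisms φ : A⁺ → S)] -/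
def IsSemigroupMorphism [Mul S] (ψ : List β → S) : Prop :=
  ∀ x y : List β, x ≠ [] → y ≠ [] → ψ (x ++ y) = ψ x * ψ y

/-- A product of nonempty words with images in a multiplicatively closed `T` has image in `T`
(used for `φ(Y⁺)` in the proof of Theorem 4.2.2). [cite: Lothaire1997, §4.2 (proof of
Theorem 4.2.2: the subsemigroup φ(Y⁺))] -/
theorem map_flatten_mem_of_isSemigroupMorphism [Mul S] {ψ : List β → S}
    (hψ : IsSemigroupMorphism ψ) (T : Finset S) (hT : ∀ x ∈ T, ∀ y ∈ T, x * y ∈ T) :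
    ∀ L : List (List β), L ≠ [] → (∀ x ∈ L, x ≠ [] ∧ ψ x ∈ T) → ψ L.flatten ∈ T := by
  intro L
  induction L with
  | nil => intro h; exact absurd rfl h
  | cons x L ih =>
    intro _ hL
    by_cases hL0 : L = []
    · subst hL0
      simpa using (hL x (by simp)).2
    · have hLne : L.flatten ≠ [] := by
        obtain ⟨y, hy⟩ := List.exists_mem_of_ne_nil L hL0
        intro hnil
        rw [List.flatten_eq_nil_iff] at hnil
        exact (hL y (by simp [hy])).1 (hnil y hy)
      rw [List.flatten_cons, hψ x L.flatten (hL x (by simp)).1 hLne]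
      exact hT _ (hL x (by simp)).2 _ (ih hL0 fun y hy => hL y (by simp [hy]))

/-- Reversing words turns a morphism into `S` into a morphism into the opposite semigroup
(the "symmetrical" case of the proof of Theorem 4.2.2). [cite: Lothaire1997, §4.2 (proof of
Theorem 4.2.2: "the opposite case is symmetrical")] -/
theorem IsSemigroupMorphism.reverse_op [Semigroup S] {ψ : List β → S}
    (hψ : IsSemigroupMorphism ψ) :
    IsSemigroupMorphism (fun w : List β => MulOpposite.op (ψ w.reverse)) := by
  intro x y hx hy
  simp only [List.reverse_append]
  rw [hψ _ _ (by simpa using hy) (by simpa using hx), MulOpposite.op_mul]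

/-- A uniform power modulo the reversed morphism, read backwards, is a uniform power modulo `ψ`.
[cite: Lothaire1997, §4.2 (proof of Theorem 4.2.2: "the opposite case is symmetrical")] -/
theorem containsUniformPowerMod_of_reverse [Semigroup S] (ψ : List β → S) (k : ℕ)
    (w : List β)
    (h : ContainsUniformPowerMod (fun v : List β => MulOpposite.op (ψ v.reverse)) k w.reverse) :
    ContainsUniformPowerMod ψ k w := by
  obtain ⟨v, hv, ws, hlen, hne, hflat, hψeq, hleneq⟩ := h
  refine ⟨v.reverse, by simpa using hv.reverse, (ws.map List.reverse).reverse, by simp [hlen],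
    ?_, ?_, ?_, ?_⟩
  · intro x hx
    simp only [List.mem_reverse, List.mem_map] at hx
    obtain ⟨y, hy, rfl⟩ := hx
    simpa using hne y hy
  · rw [← hflat, List.reverse_flatten]
  · intro x hx x' hx'
    simp only [List.mem_reverse, List.mem_map] at hx hx'
    obtain ⟨y, hy, rfl⟩ := hx
    obtain ⟨y', hy', rfl⟩ := hx'
    have := hψeq y hy y' hy'
    simpa using this
  · intro x hx x' hx'
    simp only [List.mem_reverse, List.mem_map] at hx hx'
    obtain ⟨y, hy, rfl⟩ := hx
    obtain ⟨y', hy', rfl⟩ := hx'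
    simpa using hleneq y hy y' hy'

/-- `(L.map (b ↦ concatenation of the F-images of b)).flatten` is the concatenation of the
`F`-images of `L.flatten` (reading a power over the alphabet `Y` as a word over `A`).
[cite: Lothaire1997, §4.2 (proof of Theorem 4.2.2: a word over Y considered as a word of A⁺)] -/
theorem flatten_map_flatten_map {γ δ : Type*} (L : List (List γ)) (F : γ → List δ) :
    (L.map fun b => (b.map F).flatten).flatten = (L.flatten.map F).flatten := by
  induction L with
  | nil => simp
  | cons b L ih => simp [ih]

/-- The uniform statement proved by induction on `n = Card(S)` in Theorem 4.2.2: a length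
`L = L(n, k)` that works for EVERY semigroup, every multiplicatively closed `T` with `#T ≤ n`,
every alphabet and every morphism with values in `T` ("it is possible to choose p such that …"
uses exactly this uniformity). [cite: Lothaire1997, §4.2 (proof of Theorem 4.2.2: induction
on n = Card(S))] -/
def UniformPowerBound (n k L : ℕ) : Prop :=
  ∀ (S : Type v) [Semigroup S] (T : Finset S), (∀ x ∈ T, ∀ y ∈ T, x * y ∈ T) → T.card ≤ n →
    ∀ (β : Type u) (ψ : List β → S), IsSemigroupMorphism ψ → (∀ w : List β, w ≠ [] → ψ w ∈ T) →
      ∀ w : List β, L ≤ w.length → ContainsUniformPowerMod ψ k w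

/-- If `T` has a right zero then it has at most one left zero ("if a semigroup has more than one
left zero, it cannot have any right zero"). [cite: Lothaire1997, §4.2 (proof of Theorem 4.2.2:
left and right zeroes)] -/
theorem leftZero_unique_of_rightZero [Semigroup S] (T : Finset S) {r : S} (hr : r ∈ T)
    (hrz : ∀ t ∈ T, t * r = r) :
    ∀ z₁ ∈ T, ∀ z₂ ∈ T, (∀ t ∈ T, z₁ * t = z₁) → (∀ t ∈ T, z₂ * t = z₂) → z₁ = z₂ := by
  intro z₁ hz₁ z₂ hz₂ h₁ h₂
  rw [← h₁ r hr, hrz z₁ hz₁, ← h₂ r hr, hrz z₂ hz₂]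

open scoped Classical in
/-- The heart of the proof of Theorem 4.2.2: the case where `T ⊇ φ(A⁺)` has AT MOST ONE left
zero.  Cut `w` (`|w| ≥ k l`, `l = N + 2`) into `k` consecutive factors of length `l`; if all their
images are (the) left zero they form a uniform `k`-th power; otherwise one of them, `u`, has
`φ(u)` not a left zero; van der Waerden on the colours `φ(v₁), …, φ(v_l)` of the left factors of
`u` gives `φ(v_j) = φ(v_{j+r}) = ⋯ = φ(v_{j+pr}) = s`, words `y₁, …, y_p` of length `r` with
`s φ(yᵢ) = s`, and the proper subsemigroup `T' = {t ∈ T | s t = s} ⊇ φ(Y⁺)`; the induction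
hypothesis (with `p ≥ L(n-1, k)` chosen beforehand) yields a uniform `k`-th power modulo `φ` in
`y₁ ⋯ y_p` over the alphabet `Y`, which is one over `A` since the `yᵢ` have the same length.
[cite: Lothaire1997, Theorem 4.2.2 (proof, main case)] -/
theorem containsUniformPowerMod_of_atMostOneLeftZero [Semigroup S] (T : Finset S)
    (hT : ∀ x ∈ T, ∀ y ∈ T, x * y ∈ T) (n k L' N : ℕ) (hcard : T.card ≤ n + 1)
    (hIH : UniformPowerBound.{u, v} n k L')
    (hN : ∀ c : ℕ → Fin (n + 1), ∃ a d : ℕ, 0 < d ∧ a + (max L' 1) * d ≤ N ∧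
      ∀ i < max L' 1 + 1, c (a + i * d) = c a)
    (huniq : ∀ z₁ ∈ T, ∀ z₂ ∈ T, (∀ t ∈ T, z₁ * t = z₁) → (∀ t ∈ T, z₂ * t = z₂) → z₁ = z₂)
    (ψ : List β → S) (hψ : IsSemigroupMorphism ψ) (hψT : ∀ w : List β, w ≠ [] → ψ w ∈ T)
    (w : List β) (hw : k * (N + 2) ≤ w.length) : ContainsUniformPowerMod ψ k w := by
  set p := max L' 1 with hp
  have hp1 : 1 ≤ p := le_max_right _ _
  have hpL : L' ≤ p := le_max_left _ _
  set l := N + 2 with hl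
  -- the k consecutive factors of length l
  let B : ℕ → List β := fun i => (w.take ((i + 1) * l)).drop (i * l)
  have hBlen : ∀ i, i < k → (B i).length = l := by
    intro i hi
    simp only [B, List.length_drop, List.length_take]
    have h1 : (i + 1) * l ≤ k * l := Nat.mul_le_mul_right l hi
    rw [min_eq_left (le_trans h1 hw), Nat.add_mul, one_mul]
    omega
  have hBne : ∀ i, i < k → B i ≠ [] := fun i hi =>
    List.ne_nil_of_length_pos (by rw [hBlen i hi]; omega)
  have hBT : ∀ i, i < k → ψ (B i) ∈ T := fun i hi => hψT _ (hBne i hi)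
  have hBflat : ((List.range k).map B).flatten = w.take (k * l) := by
    have := flatten_map_range_drop_take w (fun i => i * l)
      (fun i => Nat.mul_le_mul_right l (Nat.le_succ i)) k
    simpa [B] using this
  by_cases hA : ∀ i, i < k → ∀ t ∈ T, ψ (B i) * t = ψ (B i)
  · -- all the factors are (the) left zero
    refine ⟨w.take (k * l), (List.take_prefix _ _).isInfix, (List.range k).map B, by simp, ?_,
      hBflat, ?_, ?_⟩
    · intro x hx
      rw [List.mem_map] at hx
      obtain ⟨i, hi, rfl⟩ := hx
      rw [List.mem_range] at hi
      exact hBne i hi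
    · intro x hx y hy
      rw [List.mem_map] at hx hy
      obtain ⟨i, hi, rfl⟩ := hx
      obtain ⟨j, hj, rfl⟩ := hy
      rw [List.mem_range] at hi hj
      exact huniq _ (hBT i hi) _ (hBT j hj) (hA i hi) (hA j hj)
    · intro x hx y hy
      rw [List.mem_map] at hx hy
      obtain ⟨i, hi, rfl⟩ := hx
      obtain ⟨j, hj, rfl⟩ := hy
      rw [List.mem_range] at hi hj
      rw [hBlen i hi, hBlen j hj]
  · -- some factor u of length l has φ(u) not a left zero
    push Not at hA
    obtain ⟨i₀, hi₀, t₀, ht₀, hnz⟩ := hA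
    have hul : (B i₀).length = l := hBlen i₀ hi₀
    have hune : B i₀ ≠ [] := hBne i₀ hi₀
    have huw : B i₀ <:+: w := drop_take_infix w _ _
    set u := B i₀ with hu
    -- an injective coding of T by Fin (n+1)
    let enc : S → Fin (n + 1) := fun s =>
      if h : s ∈ T then Fin.castLE hcard (T.equivFin ⟨s, h⟩) else 0
    have henc : ∀ s ∈ T, ∀ s' ∈ T, enc s = enc s' → s = s' := by
      intro s hs s' hs' he
      simp only [enc, hs, hs', dif_pos] at he
      have h1 := Fin.castLE_injective hcard he
      have h2 := T.equivFin.injective h1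
      simpa using h2
    -- van der Waerden on the colours of the left factors v₁, …, v_l of u
    let c : ℕ → Fin (n + 1) := fun q => enc (ψ (u.take (q + 1)))
    obtain ⟨a, d, hd, hadN, hprog⟩ := hN c
    have hτ_le : ∀ i, i ≤ p → a + i * d + 1 ≤ N + 1 := by
      intro i hi
      have := Nat.mul_le_mul_right d hi
      omega
    have htake_ne : ∀ q, u.take (q + 1) ≠ [] := by
      intro q h
      rw [List.take_eq_nil_iff] at h
      rcases h with h | h
      · omega
      · exact hune h
    have htakeT : ∀ q, ψ (u.take (q + 1)) ∈ T := fun q => hψT _ (htake_ne q)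
    set s := ψ (u.take (a + 1)) with hs
    have hsT : s ∈ T := htakeT a
    have hcol : ∀ i, i ≤ p → ψ (u.take (a + i * d + 1)) = s := by
      intro i hi
      have h := hprog i (Nat.lt_succ_of_le hi)
      exact henc _ (htakeT _) _ (htakeT _) h
    -- the words yᵢ = u[a + i d + 1, a + (i+1) d + 1), i < p, all of length d
    let τ : ℕ → ℕ := fun i => a + i * d + 1
    have hτmono : ∀ i, τ i ≤ τ (i + 1) := fun i => by
      show a + i * d + 1 ≤ a + (i + 1) * d + 1
      nlinarith
    let y : ℕ → List β := fun i => (u.take (τ (i + 1))).drop (τ i)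
    have hylen : ∀ i, i < p → (y i).length = d := by
      intro i hi
      simp only [y, τ, List.length_drop, List.length_take]
      have h1 : a + (i + 1) * d + 1 ≤ u.length := by
        rw [hul]
        have := hτ_le (i + 1) hi
        omega
      rw [min_eq_left h1, Nat.add_mul, one_mul]
      omega
    have hyne : ∀ i, i < p → y i ≠ [] := fun i hi =>
      List.ne_nil_of_length_pos (by rw [hylen i hi]; exact hd)
    have hyT : ∀ i, i < p → ψ (y i) ∈ T := fun i hi => hψT _ (hyne i hi)
    have hsy : ∀ i, i < p → s * ψ (y i) = s := by
      intro i hi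
      have h1 : u.take (τ (i + 1)) = u.take (τ i) ++ y i := by
        simp only [y]
        conv_lhs => rw [← List.take_append_drop (τ i) (u.take (τ (i + 1)))]
        rw [List.take_take, min_eq_left (hτmono i)]
      have h2 : ψ (u.take (τ i) ++ y i) = ψ (u.take (τ i)) * ψ (y i) :=
        hψ _ _ (htake_ne _) (hyne i hi)
      rw [← h1] at h2
      have h3 : ψ (u.take (τ i)) = s := hcol i hi.le
      have h4 : ψ (u.take (τ (i + 1))) = s := hcol (i + 1) hi
      rw [h4, h3] at h2
      exact h2.symm
    -- the proper subsemigroup T' = {t ∈ T | s t = s} ⊇ φ(Y⁺)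
    set T' := T.filter (fun t => s * t = s) with hT'
    have hT'mem : ∀ t, t ∈ T' ↔ t ∈ T ∧ s * t = s := fun t => Finset.mem_filter
    have hT'mul : ∀ x ∈ T', ∀ y ∈ T', x * y ∈ T' := by
      intro x hx y' hy
      rw [hT'mem] at hx hy ⊢
      exact ⟨hT _ hx.1 _ hy.1, by rw [← mul_assoc, hx.2, hy.2]⟩
    have hT'card : T'.card ≤ n := by
      have hnotlz : ∃ t ∈ T, s * t ≠ s := by
        by_contra hcon
        push Not at hcon
        have hrest : u.drop (τ p) ≠ [] := by
          intro h
          rw [List.drop_eq_nil_iff] at h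
          have := hτ_le p le_rfl
          simp only [τ] at h
          omega
        have h2 : ψ (u.take (τ p) ++ u.drop (τ p)) = ψ (u.take (τ p)) * ψ (u.drop (τ p)) :=
          hψ _ _ (htake_ne _) hrest
        rw [List.take_append_drop, hcol p le_rfl, hcon _ (hψT _ hrest)] at h2
        -- h2 : ψ u = s, so ψ u is a left zero of T: contradiction
        exact hnz (by rw [h2]; exact hcon t₀ ht₀)
      obtain ⟨t, ht, hne⟩ := hnotlz
      have hss : T' ⊂ T := Finset.filter_ssubset.2 ⟨t, ht, hne⟩
      have := Finset.card_lt_card hss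
      omega
    -- the morphism on words over the alphabet of the yᵢ (letters: indices, junk ↦ y 0)
    let f : ℕ → List β := fun i => if i < p then y i else y 0
    have hf : ∀ i, f i ≠ [] ∧ ψ (f i) ∈ T' := by
      intro i
      by_cases hi : i < p
      · simp only [f, if_pos hi]
        exact ⟨hyne i hi, (hT'mem _).2 ⟨hyT i hi, hsy i hi⟩⟩
      · simp only [f, if_neg hi]
        exact ⟨hyne 0 hp1, (hT'mem _).2 ⟨hyT 0 hp1, hsy 0 hp1⟩⟩
    have hflen : ∀ i, i < p → (f i).length = d := by
      intro i hi
      simp only [f, if_pos hi, hylen i hi]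
    let g : List (ULift.{u} ℕ) → List β := fun is => (is.map fun i => f i.down).flatten
    have hg_app : ∀ is js, g (is ++ js) = g is ++ g js := fun is js => by
      simp [g, List.map_append, List.flatten_append]
    have hg_ne : ∀ is, is ≠ [] → g is ≠ [] := by
      intro is his h
      obtain ⟨i, hi⟩ := List.exists_mem_of_ne_nil is his
      have h' : f i.down ∈ (is.map fun i => f i.down) := List.mem_map.2 ⟨i, hi, rfl⟩
      rw [List.flatten_eq_nil_iff] at h
      exact (hf i.down).1 (h _ h')
    have hg_T' : ∀ is, is ≠ [] → ψ (g is) ∈ T' := by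
      intro is his
      apply map_flatten_mem_of_isSemigroupMorphism hψ T' hT'mul _ (by simpa using his)
      intro x hx
      rw [List.mem_map] at hx
      obtain ⟨i, -, rfl⟩ := hx
      exact hf i.down
    let ψ' : List (ULift.{u} ℕ) → S := fun is => ψ (g is)
    have hψ' : IsSemigroupMorphism ψ' := by
      intro is js his hjs
      show ψ (g (is ++ js)) = ψ (g is) * ψ (g js)
      rw [hg_app]
      exact hψ _ _ (hg_ne is his) (hg_ne js hjs)
    -- the induction hypothesis, applied to the word y₁ y₂ ⋯ y_p over the alphabet Y
    let ι : List (ULift.{u} ℕ) := (List.range p).map ULift.up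
    have hι : L' ≤ ι.length := by simpa [ι] using hpL
    obtain ⟨v', hv', ws', hlen', hne', hflat', hψeq', hleneq'⟩ :=
      hIH S T' hT'mul hT'card (ULift.{u} ℕ) ψ' hψ' (fun is his => hg_T' is his) ι hι
    -- back to the alphabet A
    have hgι : g ι = (u.take (τ p)).drop (τ 0) := by
      have h1 : g ι = ((List.range p).map y).flatten := by
        simp only [g, ι, List.map_map]
        congr 1
        apply List.map_congr_left
        intro i hi
        rw [List.mem_range] at hi
        simp [Function.comp, f, hi]
      rw [h1]
      exact flatten_map_range_drop_take u τ hτmono p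
    have hv : g v' <:+: w := by
      obtain ⟨pre, suf, he⟩ := hv'
      have h1 : g v' <:+: g ι := ⟨g pre, g suf, by rw [← hg_app, ← hg_app, he]⟩
      rw [hgι] at h1
      exact h1.trans ((drop_take_infix u _ _).trans huw)
    have hltp : ∀ b ∈ ws', ∀ i ∈ b, i.down < p := by
      intro b hb i hi
      have h1 : i ∈ v' := by
        rw [← hflat']
        exact List.mem_flatten.2 ⟨b, hb, hi⟩
      have h2 : i ∈ ι := hv'.subset h1
      simp only [ι, List.mem_map, List.mem_range] at h2
      obtain ⟨j, hj, rfl⟩ := h2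
      exact hj
    have hglen : ∀ b ∈ ws', (g b).length = b.length * d := by
      intro b hb
      simp only [g, List.length_flatten, List.map_map]
      have h1 : b.map (List.length ∘ fun i => f i.down) = b.map (fun _ => d) := by
        apply List.map_congr_left
        intro i hi
        simp [Function.comp, hflen _ (hltp b hb i hi)]
      rw [h1, List.map_const', List.sum_replicate, smul_eq_mul]
    refine ⟨g v', hv, ws'.map g, by simp [hlen'], ?_, ?_, ?_, ?_⟩
    · intro x hx
      rw [List.mem_map] at hx
      obtain ⟨b, hb, rfl⟩ := hx
      exact hg_ne b (hne' b hb)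
    · rw [← hflat']
      exact flatten_map_flatten_map ws' (fun i => f i.down)
    · intro x hx x' hx'
      rw [List.mem_map] at hx hx'
      obtain ⟨b, hb, rfl⟩ := hx
      obtain ⟨b', hb', rfl⟩ := hx'
      exact hψeq' b hb b' hb'
    · intro x hx x' hx'
      rw [List.mem_map] at hx hx'
      obtain ⟨b, hb, rfl⟩ := hx
      obtain ⟨b', hb', rfl⟩ := hx'
      rw [hglen b hb, hglen b' hb', hleneq' b hb b' hb']

open scoped Classical in
/-- The induction step of Theorem 4.2.2: from the uniform bound for semigroups of at most `n`
elements to those of at most `n + 1`, distinguishing whether `T` has at most one left zero (main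
case) or several — then `T` has no right zero and the symmetric argument (the main case in the
opposite semigroup, on reversed words) applies. [cite: Lothaire1997, Theorem 4.2.2 (proof,
induction step)] -/
theorem uniformPowerBound_succ (n k L' N : ℕ) (hIH : UniformPowerBound.{u, v} n k L')
    (hN : ∀ c : ℕ → Fin (n + 1), ∃ a d : ℕ, 0 < d ∧ a + (max L' 1) * d ≤ N ∧
      ∀ i < max L' 1 + 1, c (a + i * d) = c a) :
    UniformPowerBound.{u, v} (n + 1) k (k * (N + 2)) := by
  intro S _ T hT hcard β ψ hψ hψT w hw
  by_cases h1 : ∀ z₁ ∈ T, ∀ z₂ ∈ T, (∀ t ∈ T, z₁ * t = z₁) → (∀ t ∈ T, z₂ * t = z₂) → z₁ = z₂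
  · exact containsUniformPowerMod_of_atMostOneLeftZero T hT n k L' N hcard hIH hN h1 ψ hψ hψT
      w hw
  · push Not at h1
    obtain ⟨z₁, hz₁, z₂, hz₂, hl₁, hl₂, hne⟩ := h1
    have hnr : ∀ r ∈ T, ¬ ∀ t ∈ T, t * r = r := fun r hr hcon =>
      hne (leftZero_unique_of_rightZero T hr hcon z₁ hz₁ z₂ hz₂ hl₁ hl₂)
    -- the opposite semigroup: its left zeros are the right zeros of T, so there are none
    let To : Finset Sᵐᵒᵖ := T.map MulOpposite.opEquiv.toEmbedding
    have hTo_mem : ∀ x, x ∈ To ↔ MulOpposite.unop x ∈ T := by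
      intro x
      simp [To]
    have hTo : ∀ x ∈ To, ∀ y ∈ To, x * y ∈ To := by
      intro x hx y hy
      rw [hTo_mem] at hx hy ⊢
      rw [MulOpposite.unop_mul]
      exact hT _ hy _ hx
    have hTo_card : To.card ≤ n + 1 := by simpa [To] using hcard
    have hTo_uniq : ∀ z₁ ∈ To, ∀ z₂ ∈ To, (∀ t ∈ To, z₁ * t = z₁) → (∀ t ∈ To, z₂ * t = z₂) →
        z₁ = z₂ := by
      intro x hx _ _ hlx _
      exfalso
      refine hnr (MulOpposite.unop x) ((hTo_mem x).1 hx) fun t ht => ?_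
      have h2 := hlx (MulOpposite.op t) ((hTo_mem _).2 (by simpa using ht))
      have h3 := congrArg MulOpposite.unop h2
      simpa using h3
    let ψo : List β → Sᵐᵒᵖ := fun v => MulOpposite.op (ψ v.reverse)
    have hψo : IsSemigroupMorphism ψo := hψ.reverse_op
    have hψoT : ∀ v : List β, v ≠ [] → ψo v ∈ To := by
      intro v hv
      rw [hTo_mem]
      simpa [ψo] using hψT v.reverse (by simpa using hv)
    have := containsUniformPowerMod_of_atMostOneLeftZero To hTo n k L' N hTo_card hIH hN
      hTo_uniq ψo hψo hψoT w.reverse (by simpa using hw)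
    exact containsUniformPowerMod_of_reverse ψ k w this

/-- The uniform bound `L(n, k)` exists for every `n` (induction on `n = Card(S)`, the base case
being vacuous/trivial). [cite: Lothaire1997, Theorem 4.2.2 (proof: "We use an induction on n")] -/
theorem exists_uniformPowerBound (n k : ℕ) : ∃ L, UniformPowerBound.{u, v} n k L := by
  induction n with
  | zero =>
    refine ⟨1, ?_⟩
    intro S _ T hT hcard β ψ hψ hψT w hw
    have hT0 : T = ∅ := Finset.card_eq_zero.1 (Nat.le_zero.1 hcard)
    have hw' : w ≠ [] := List.ne_nil_of_length_pos hw
    have := hψT w hw'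
    rw [hT0] at this
    simp at this
  | succ n ih =>
    obtain ⟨L', hL'⟩ := ih
    obtain ⟨N, hN⟩ := vanDerWaerden (Fin (n + 1)) (max L' 1 + 1)
    exact ⟨k * (N + 2), uniformPowerBound_succ n k L' N hL' (by simpa using hN)⟩

/-- **Theorem 4.2.2**: a morphism `φ : A⁺ → S` from `A⁺` to a finite semigroup `S` is uniformly
repetitive — a refinement of Theorem 4.1.1 for morphisms and a generalization of van der
Waerden's theorem. [cite: Lothaire1997, Theorem 4.2.2] -/
theorem isUniformlyRepetitive_of_isSemigroupMorphism [Semigroup S] [Finite S] (ψ : List β → S)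
    (hψ : IsSemigroupMorphism ψ) : IsUniformlyRepetitive ψ := by
  classical
  haveI := Fintype.ofFinite S
  intro k
  obtain ⟨L, hL⟩ := exists_uniformPowerBound.{u, v} (Fintype.card S) k
  exact ⟨L, fun w hw => hL S Finset.univ (by simp) (by simp) β ψ hψ (by simp) w hw⟩

/-- In particular such a morphism is repetitive (Theorem 4.1.1 for morphisms, recovered).
[cite: Lothaire1997, Theorem 4.2.2 (a refinement of Theorem 4.1.1)] -/
theorem isRepetitive_of_isSemigroupMorphism [Semigroup S] [Finite S] (ψ : List β → S)
    (hψ : IsSemigroupMorphism ψ) : IsRepetitive ψ := by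
  intro k
  obtain ⟨L, hL⟩ := isUniformlyRepetitive_of_isSemigroupMorphism ψ hψ k
  refine ⟨L, fun w hw => ?_⟩
  obtain ⟨v, hv, ws, h1, h2, h3, h4, -⟩ := hL w hw
  exact ⟨v, hv, ws, h1, h2, h3, h4⟩

/-! ### Van der Waerden's theorem as a particular case of Theorem 4.2.2 (closing remark of §4.2) -/

section FirstLetter

variable (β)

/-- The quotient of `A⁺` by the congruence generated by the relations `ab ∼ a` (`a, b ∈ A`) is the
*left-zero semigroup* on `A` (`a · b = a`); we realise it on a copy of the alphabet.
[cite: Lothaire1997, §4.2 (closing remark: the congruence generated by ab ∼ a)] -/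
def LeftZeroBand (β : Type u) : Type u := β

/-- `a · b = a`. [cite: Lothaire1997, §4.2 (closing remark: ab ∼ a)] -/
instance LeftZeroBand.instSemigroup : Semigroup (LeftZeroBand β) where
  mul a _ := a
  mul_assoc _ _ _ := rfl

/-- [cite: Lothaire1997, §4.2 (closing remark)] -/
instance LeftZeroBand.instFinite [Finite β] : Finite (LeftZeroBand β) := ‹Finite β›

/-- [cite: Lothaire1997, §4.2 (closing remark)] -/
instance LeftZeroBand.instDecidableEq [DecidableEq β] : DecidableEq (LeftZeroBand β) :=
  ‹DecidableEq β›

/-- The adjoined-unit version is finite too (so Theorem 4.2.2 applies).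
[cite: Lothaire1997, §4.2 (closing remark)] -/
instance LeftZeroBand.instFiniteWithOne [Finite β] : Finite (WithOne (LeftZeroBand β)) := by
  haveI := Fintype.ofFinite β
  exact inferInstanceAs (Finite (Option β))

variable {β} in
/-- The class of the letter `a`. [cite: Lothaire1997, §4.2 (closing remark)] -/
def LeftZeroBand.of (a : β) : LeftZeroBand β := a

variable {β}

/-- The canonical morphism `A⁺ → A⁺/(ab ∼ a)`: a nonempty word goes to (the class of) its first
letter; the empty word goes to the adjoined unit. [cite: Lothaire1997, §4.2 (closing remark: the
morphism from A⁺ to its quotient)] -/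
def firstLetter (w : List β) : WithOne (LeftZeroBand β) := w.head?

/-- [cite: Lothaire1997, §4.2 (closing remark)] -/
theorem firstLetter_cons (a : β) (w : List β) :
    firstLetter (a :: w) = ((LeftZeroBand.of a : LeftZeroBand β) : WithOne (LeftZeroBand β)) :=
  rfl

/-- `firstLetter` is a morphism of semigroups `A⁺ → A⁺/(ab ∼ a)`.
[cite: Lothaire1997, §4.2 (closing remark: the morphism from A⁺ to its quotient)] -/
theorem isSemigroupMorphism_firstLetter : IsSemigroupMorphism (firstLetter (β := β)) := by
  intro x y hx hy
  obtain ⟨a, x', rfl⟩ := List.exists_cons_of_ne_nil hx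
  obtain ⟨b, y', rfl⟩ := List.exists_cons_of_ne_nil hy
  rw [List.cons_append, firstLetter_cons, firstLetter_cons, firstLetter_cons, ← WithOne.coe_mul]
  rfl

/-- Two nonempty words are congruent modulo `ab ∼ a` iff they have the same first letter.
[cite: Lothaire1997, §4.2 (closing remark)] -/
theorem firstLetter_eq_firstLetter_iff (x y : List β) :
    firstLetter x = firstLetter y ↔ x.head? = y.head? := Iff.rfl

/-- In a concatenation of blocks of a common length `ℓ`, position `ℓ s + j` (`j < ℓ`) reads the
`j`-th letter of block `s`. [cite: Lothaire1997, §4.2 (closing remark: w = w₀ a w₁ a w₂ ⋯ a w_k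
with the wᵢ of the same length)] -/
theorem getElem?_flatten_of_forall_length_eq {γ : Type*} (ws : List (List γ)) (ℓ : ℕ)
    (hℓ : ∀ x ∈ ws, x.length = ℓ) (s : ℕ) (hs : s < ws.length) (j : ℕ) (hj : j < ℓ) :
    ws.flatten[ℓ * s + j]? = ws[s][j]? := by
  induction ws generalizing s with
  | nil => simp at hs
  | cons x ws ih =>
    have hx : x.length = ℓ := hℓ x (by simp)
    cases s with
    | zero =>
      rw [List.flatten_cons, Nat.mul_zero, Nat.zero_add, List.getElem?_append_left (by omega)]
      simp
    | succ s =>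
      have hs' : s < ws.length := by simpa using hs
      rw [List.flatten_cons, List.getElem?_append_right (by rw [hx, Nat.mul_succ]; omega),
        show ℓ * (s + 1) + j - x.length = ℓ * s + j by rw [hx, Nat.mul_succ]; omega,
        ih (fun z hz => hℓ z (by simp [hz])) s hs']
      simp

/-- The length of a concatenation of `k` blocks of length `ℓ` is `k ℓ`.
[cite: Lothaire1997, §4.2 (closing remark)] -/
theorem length_flatten_of_forall_length_eq {γ : Type*} (ws : List (List γ)) (ℓ : ℕ)
    (hℓ : ∀ x ∈ ws, x.length = ℓ) : ws.flatten.length = ws.length * ℓ := by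
  rw [List.length_flatten]
  have : ws.map List.length = ws.map (fun _ => ℓ) := List.map_congr_left hℓ
  rw [this, List.map_const', List.sum_replicate, smul_eq_mul]

/-- "A uniform `k`-th power modulo `φ` (`φ : A⁺ → A⁺/(ab ∼ a)`) is just a word that contains an
arithmetic cadence of order `k`": a factor `w₁ ⋯ w_k` of `w` with `|w₁| = ⋯ = |w_k|` and a
common first letter gives the arithmetic cadence of the positions of these first letters.  Hence
Theorem 4.2.2 for this morphism yields van der Waerden's theorem in the form of
Proposition 3.3.1 (`exists_length_forcing_arithCadence`). [cite: Lothaire1997, §4.2 (closing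
remark: van der Waerden's theorem is a particular case of Theorem 4.2.2)] -/
theorem hasArithCadence_of_containsUniformPowerMod_firstLetter (k : ℕ) (w : List β)
    (h : ContainsUniformPowerMod (firstLetter (β := β)) k w) : HasArithCadence w k := by
  classical
  obtain ⟨v, ⟨pre, suf, hw⟩, ws, hlen, hne, hflat, hψ, hleq⟩ := h
  rcases Nat.eq_zero_or_pos k with rfl | hk
  · exact ⟨1, 1, Nat.one_pos, Nat.one_pos, by simp [IsCadence]⟩
  -- the common block length ℓ ≥ 1
  have hws : ws ≠ [] := List.ne_nil_of_length_pos (by omega)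
  obtain ⟨x₀, hx₀⟩ := List.exists_mem_of_ne_nil ws hws
  set ℓ := x₀.length with hℓdef
  have hℓ : ∀ x ∈ ws, x.length = ℓ := fun x hx => hleq x hx x₀ hx₀
  have hℓpos : 0 < ℓ := List.length_pos_of_ne_nil (hne x₀ hx₀)
  have hvlen : v.length = ℓ * k := by
    rw [← hflat, length_flatten_of_forall_length_eq ws ℓ hℓ, hlen, Nat.mul_comm]
  have hwlen : w.length = pre.length + v.length + suf.length := by
    rw [← hw]
    simp only [List.length_append]
  -- all the first letters are equal: v[ℓ s] = v[0]
  have hfirst : ∀ s, s < k → v[ℓ * s]? = v[0]? := by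
    intro s hs
    have hsk : s < ws.length := by omega
    have h0 : 0 < ws.length := by omega
    have h1 := getElem?_flatten_of_forall_length_eq ws ℓ hℓ s hsk 0 hℓpos
    have h2 := getElem?_flatten_of_forall_length_eq ws ℓ hℓ 0 h0 0 hℓpos
    simp only [hflat, Nat.add_zero, Nat.mul_zero] at h1 h2
    rw [h1, h2, ← List.head?_eq_getElem?, ← List.head?_eq_getElem?,
      ← firstLetter_eq_firstLetter_iff]
    exact hψ _ (List.getElem_mem hsk) _ (List.getElem_mem h0)
  -- the letter of w at position ℓ s + |pre| + 1 (1-indexed) is v[ℓ s]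
  have key : ∀ s, s < k → w[ℓ * s + (pre.length + 1) - 1]? = v[ℓ * s]? := by
    intro s hs
    have h0 : ℓ * s + ℓ ≤ ℓ * k := by
      rw [← Nat.mul_succ]
      exact Nat.mul_le_mul_left ℓ hs
    have h1 : ℓ * s < v.length := by
      rw [hvlen]
      omega
    rw [← hw, List.append_assoc, List.getElem?_append_right (by omega),
      show ℓ * s + (pre.length + 1) - 1 - pre.length = ℓ * s by omega,
      List.getElem?_append_left h1]
  refine ⟨ℓ, pre.length + 1, hℓpos, Nat.succ_pos _, ?_, ?_⟩
  · intro t ht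
    simp only [Finset.mem_image, Finset.mem_range] at ht
    obtain ⟨s, hs, rfl⟩ := ht
    have h0 : ℓ * s + ℓ ≤ ℓ * k := by
      rw [← Nat.mul_succ]
      exact Nat.mul_le_mul_left ℓ hs
    constructor <;> omega
  · intro t ht t' ht'
    simp only [Finset.mem_image, Finset.mem_range] at ht ht'
    obtain ⟨s, hs, rfl⟩ := ht
    obtain ⟨s', hs', rfl⟩ := ht'
    rw [key s hs, key s' hs', hfirst s hs, hfirst s' hs']

/-- Theorem 4.2.2 for the morphism `A⁺ → A⁺/(ab ∼ a)` gives back van der Waerden's theorem on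
arithmetic cadences (Proposition 3.3.1, in the tree as `exists_length_forcing_arithCadence`;
stated here as an `example`, not re-filed).
[cite: Lothaire1997, §4.2 (closing remark: van der Waerden's theorem as a case of Theorem 4.2.2)] -/
example (β : Type u) [Finite β] (n : ℕ) :
    ∃ N : ℕ, ∀ u : List β, N ≤ u.length → HasArithCadence u n := by
  obtain ⟨N, hN⟩ :=
    isUniformlyRepetitive_of_isSemigroupMorphism (firstLetter (β := β))
      isSemigroupMorphism_firstLetter n
  exact ⟨N, fun u hu => hasArithCadence_of_containsUniformPowerMod_firstLetter n u (hN u hu)⟩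

end FirstLetter

end Semigroups

end RepetitiveMorphisms

end Literature.Combinatorics.Words
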